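import Summits.MatrixMultiplication.MatrixMultiplication.Theses.FidelityWitnesses
import Summits.MatrixMultiplication.MatrixMultiplication.Theorems.FidelityGapThreeSeventeen.Negative.BorderRankReduction

/-!
# Line `sticky-saturation-slip` for crux `FidelityWitnesses.FidelityGapThreeSeventeen` (stmt-MatrixMultiplication-4958)

Skeleton (crux-plan, planner-cruxplan-stmt-MatrixMultiplication-4958-sticky-saturation-sl-0, 2026-08-16) of
idea card `Cruxes/FidelityGapThreeSeventeen/Ideas/sticky-saturation-slip.md` (crux-ideate r1, ideator 2; triage
r1-1 / r1-2 / r1-3: **pass** ×3, merge-adjacent to `punctual-saturation`; sharpenings built in, see the line card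
`Lines/sticky-saturation-slip.md`).

THE CRUX. `FidelityGapThreeSeventeen : ∃ ε > 0, ∀ S, tensorRank S ≤ 17 → ‖∑ S·⟨3,3,3⟩‖² ≤ (1 − ε)·27·∑‖S‖²`,
KERNEL-CERTIFIED equivalent to `18 ≤ R̲(⟨3,3,3⟩)` (`Disproof.crux_iff_eighteen_le_algBorderRank`; the landed
half used here is `Theorems.algBorderRank_le_seventeen_of_not_fidelityGapThreeSeventeen`, Negative lane p73201).

THE LINE (Jelisiejew–Mańdziuk STICKY IDEALS on the Borel-fixed residue of border apolarity). Everything is stated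
over HONEST objects of commutative algebra, all in Mathlib: the Cox ring `S = ℂ[Var]` of `ℙA × ℙB × ℙC`
(`Var = Fin 3 × (Fin 3 × Fin 3)` = (slot, index pair), `27` variables, `ℕ³`-graded by the slot, `Spiece D`),
honest ideals `I : Ideal S`, and ARCS of `r` points `Γ : Fin r → Var → ℂ⟦ε⟧` (power-series coordinates; HONEST =
every slot vector has a unit coordinate, `IsHonestArc`). `IsArcLimit Γ I` says that in EVERY multidegree `D` the
piece `I_D` is the set of reductions mod `ε` of the degree-`D` forms over `ℂ⟦ε⟧` vanishing on `Γ` — i.e. `I` is the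
special fibre of the flat family `Λ(Γ) ⊆ S ⊗ ℂ⟦ε⟧` of vanishing ideals, whose generic fibre is the SATURATED ideal
of `r` points over `ℂ((ε))`: a `ℂ⟦ε⟧`-point of the multigraded Hilbert scheme `Hilb^{h_I}` through `[I]`, exactly the
family `K_t` of Jelisiejew–Mańdziuk 2025, proof of Thm 3.4. With `HasGenericHF 17 I` (codim `I_D = min(17, dim S_D)`
in every `D`) and `AnnihilatesT I` (`⟨3,3,3⟩ ⟂ I₁₁₁`) this is a point of `Slip₁₇ ∩ {T ⟂ I₁₁₁}` (Buczyńska–Buczyński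
border apolarity, sequential/arc form — no Hilbert scheme is needed to STATE anything).
* `stub_pointArc_of_algBorderRank_le` (WEAK BORDER APOLARITY, arc form; size L, tree technology): `R̲(⟨3,3,3⟩) ≤ 17`
  gives an approximate decomposition over `ℂ[ε]` (`IsApproxDecomposition`); pad to `17` triads, perturb each slot
  vector by `ε^M ·` (very general constant vector), `M > h` (keeps the order-`h` identity, cf. the tree's
  `BorderApolarity.isApproxDecomposition_pert₁₂`), normalise slots by powers of `ε` (honest arc, same vanishing
  lattices); `I := ⊕_D lim_D` is a homogeneous ideal, `IsArcLimit` by construction, `HasGenericHF 17` = general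
  position of the generic configuration in every multidegree (very general perturbation; countably many proper
  Zariski-closed bad loci, `ℂ` uncountable), `AnnihilatesT` = the `ε^h`-coefficient of `⟨F(ε), ∑ u⊗v⊗w⟩ = 0`.
* `stub_borelFixed_pointArc` (BOREL-FIXED NORMAL FORM = Buczyńska–Buczyński 2021 Thm 4.3 / CHL 2023 §2.4, arc form;
  size XL, classical AG absent from Mathlib): `Slip₁₇^{h₁₇} ∩ {T ⟂ I₁₁₁}` is a non-empty closed `B`-stable subset of
  the projective Haiman–Sturmfels Hilbert scheme, `B = B_X × B_Y × B_Z ⊂ G_T` connected solvable (it acts on `S` by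
  the derivations `derivOf (rootImg s i j)`, `i ≤ j`; checked to annihilate the `T`-pairing and to satisfy the `𝔤𝔩₃³`
  relations), so the Borel fixed point theorem gives a `B`-fixed `[I']`; curve selection + completion + a very
  general `ε^M`-perturbation (finite supportive set of degrees, Haiman–Sturmfels uniqueness) realise `[I']` as an
  honest arc limit with `HasGenericHF 17`.
* `stub_candidate_not_saturated` (NO `B`-STABLE CACTUS-17 EXPRESSION AT THE CORNER; size M–L, finite linear algebra;
  triage r1-3 "step 0", both saturation cards' falsifier): a Borel-fixed candidate is never saturated — a saturated
  one would be `I(Z)`, `Z` a `B`-stable length-`17` scheme supported at the unique `B`-fixed point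
  `P₀ ∈ ℙA × ℙB × ℙC` with `⟨3,3,3⟩ ∈ ⟨Z⟩` and Hilbert function EXACTLY `min(17, dim S_D)` in all degrees.
* `stub_stickyCertificate` (THE LEVER = the card's transfer `C⁺`; size XL, classification + exact linear algebra
  off-box, Lean replays rank identities; HARDEST): every nonsaturated Borel-fixed candidate admits `J` with
  `I ⊊ J ⊆ I^{sat}` and vanishing fibre obstruction `ObFib(I,J) = Ext¹_S(J/I, S/J)₀ = 0`, rendered WITHOUT homological
  algebra as `ObFibVanishes I J`: for a presentation of `J/I` by homogeneous generators `g` of `J` mod `I`, every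
  degree-`0` `S`-linear map from the syzygy module `syz I g = {x : ∑ xᵢgᵢ ∈ I}` to `S/J` extends to the free module
  (`Hom(F,S/J)₀ → Hom(K,S/J)₀ → Ext¹(J/I,S/J)₀ → 0`).
* `stub_sticky_not_arcLimit` (JELISIEJEW–MAŃDZIUK Thm 3.4 = Thm 1.2, arc form; size XL, deformation theory of the flag
  Hilbert scheme): `I ⊊ J ⊆ I^{sat}`, both homogeneous, `ObFib(I,J) = 0` ⟹ `I` is the arc limit of NO honest arc
  (smoothness of `pr_I : HilbFlag → Hilb` at `[I ⊆ J]` lifts the `ℂ⟦ε⟧`-point `Λ(Γ)`; `J_η ⊋ Λ(Γ)_η` with equal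
  Hilbert functions in large degrees contradicts saturation of `Λ(Γ)_η = I(Γ_η)`).
* `FidelityGapThreeSeventeen_of` — the kernel-checked composition: `¬crux ⟹ R̲ ≤ 17` (landed reduction) ⟹ honest
  arc limit in `Slip₁₇ ∩ {T ⟂}` ⟹ Borel-fixed one ⟹ nonsaturated ⟹ sticky `J` ⟹ not an arc limit — absurd.

Disproof.lean (cdisprove, 2026-08-16T01:34Z) — USED: `crux_iff_eighteen_le_algBorderRank` /
`algBorderRank_le_seventeen_of_not_crux` (the line re-enters the crux through `18 ≤ R̲`; its landed twin
`Theorems.algBorderRank_le_seventeen_of_not_fidelityGapThreeSeventeen` is the first step of the composition);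
`not_fidelityGapThree_twenty` (Smirnov, kernel-checked `R̲ ≤ 20`): the hypothesis "17" is load-bearing and enters
ONLY through `HasGenericHF 17` / `Fin 17` — the same skeleton with `20` must fail, and it fails exactly at
`stub_stickyCertificate`/`stub_candidate_not_saturated` (a genuine Borel-fixed limit of Smirnov's scheme is in `Slip₂₀`, so
by `stub_sticky_not_arcLimit` it admits NO `J` with `ObFib = 0`: the calibration run of the line card);
`crux_false_without_rankBound` honoured the same way; §3 tightness (`gapAt_seventeen_le_seven`, `ε ≤ 7/27`) is
irrelevant — the line is qualitative (`∃ ε` comes from the reduction, no constant is claimed). No `_false_without_`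
theorem other than the rank bound exists; no `Theorems/FidelityGapThreeSeventeen/Negative/*` lemma refutes any stub
(`BorderRankReduction`, `Tightness` only). Negatives index (`ledger negatives --problem MatrixMultiplication`, 4 entries:
level-graded Cohn–Umans 7612, algebraic STPP designs 9732/9721, design flattening 8036) — unrelated statements about
group-theoretic designs; no stub is an instance of one.
-/

noncomputable section

namespace Summit.MatrixMultiplication.MatrixMultiplication.Cruxes.FidelityGapThreeSeventeen.StickySaturationSlip

open scoped BigOperators Polynomial
open Literature.Computability.AlgebraicComplexity
open Summit.MatrixMultiplication.MatrixMultiplication.Theses.FidelityWitnesses (FidelityGapThreeSeventeen)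

set_option linter.unusedVariables false
set_option linter.dupNamespace false

/-! ## Vocabulary: the `ℕ³`-graded Cox ring of `ℙA × ℙB × ℙC` -/

/-- Index pairs: a slot of `⟨3,3,3⟩` (`matMulTensor ℂ 3 3 3 a b c`, `a = (x,y)`, `b = (x,z)`, `c = (z,y)`). -/
abbrev Pair : Type := Fin 3 × Fin 3

/-- The `27` variables of the Cox ring: `(slot, pair)`; slot `0` = coordinates `α_a` on `A`, slot `1` = `β_b` on
`B`, slot `2` = `γ_c` on `C`. -/
abbrev Var : Type := Fin 3 × Pair

/-- The Cox ring `S = Sym A* ⊗ Sym B* ⊗ Sym C* = ℂ[α, β, γ]` of `ℙA × ℙB × ℙC` (`A = B = C = ℂ⁹`). -/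
abbrev S : Type := MvPolynomial Var ℂ

/-- Multidegrees `ℕ³`. -/
abbrev MDeg : Type := Fin 3 → ℕ

/-- The `ℕ³`-grading: a slot-`s` variable has multidegree `e_s`. -/
def wt : Var → MDeg := fun v => Pi.single v.1 1

/-- The graded piece `S_D` (multihomogeneous forms of multidegree `D`), as a `ℂ`-subspace of `S`. -/
def Spiece (D : MDeg) : Submodule ℂ S := MvPolynomial.weightedHomogeneousSubmodule ℂ wt D

/-- The piece `I_D = I ∩ S_D` of an ideal. -/
def pieceOf (I : Ideal S) (D : MDeg) : Submodule ℂ S := (Submodule.restrictScalars ℂ I) ⊓ Spiece D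

/-- `I` is homogeneous for the `ℕ³`-grading (every multihomogeneous component of a member is a member). -/
def IsHomogIdeal (I : Ideal S) : Prop :=
  ∀ p ∈ I, ∀ D : MDeg, MvPolynomial.weightedHomogeneousComponent wt D p ∈ I

/-- `S/I` has the GENERIC HILBERT FUNCTION OF `r` POINTS: `codim_{S_D} I_D = min (r, dim S_D)` in EVERY multidegree
(`dim S_D = ∏_s C(D_s + 8, 8)`; e.g. `I₁₀₀ = 0`, `codim I₁₁₀ = codim I₁₁₁ = r` for `r ≤ 81`). For a candidate limit
ideal this subsumes all of Conner–Harper–Landsberg's dimension tests `(110)`, `(210)`, `(120)`, `(111)`, …. -/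
def HasGenericHF (r : ℕ) (I : Ideal S) : Prop :=
  ∀ D : MDeg, Module.finrank ℂ (pieceOf I D) + min r (Module.finrank ℂ (Spiece D)) = Module.finrank ℂ (Spiece D)

/-- The multidegree `(1,1,1)`. -/
def triDeg : MDeg := fun _ => 1

/-- The exponent vector of the trilinear monomial `α_a β_b γ_c`. -/
def triMono (a b c : Pair) : Var →₀ ℕ :=
  Finsupp.single ((0 : Fin 3), a) 1 + Finsupp.single ((1 : Fin 3), b) 1 + Finsupp.single ((2 : Fin 3), c) 1

/-- The pairing of (the `(1,1,1)`-part of) `p ∈ S` with `T = ⟨3,3,3⟩ ∈ A ⊗ B ⊗ C`: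
`⟨p, T⟩ = ∑_{a,b,c} [α_a β_b γ_c] p · T_{abc}`. -/
def pairT (p : S) : ℂ :=
  ∑ a : Pair, ∑ b : Pair, ∑ c : Pair, MvPolynomial.coeff (triMono a b c) p * matMulTensor ℂ 3 3 3 a b c

/-- `⟨3,3,3⟩ ⟂ I₁₁₁` — the apolarity condition of (weak) border apolarity in the one degree where it is not void. -/
def AnnihilatesT (I : Ideal S) : Prop := ∀ p ∈ I, p ∈ Spiece triDeg → pairT p = 0

/-- Images of the variables under the root / toral generator `E_{ij}` of the `s`-th factor of
`𝔤𝔩(X) × 𝔤𝔩(Y) × 𝔤𝔩(Z)` (`A = X ⊗ Y ∋ e_{(x,y)}`, `B = X* ⊗ Z ∋ e_{(x,z)}`, `C = Z* ⊗ Y* ∋ e_{(z,y)}`, on which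
`⟨3,3,3⟩ = ∑ e_{(x,y)} ⊗ e_{(x,z)} ⊗ e_{(z,y)}` is the invariant; the ring `S` carries the dual action):
`s = 0` (`X`): `α_{(i,y)} ↦ −α_{(j,y)}`, `β_{(j,z)} ↦ β_{(i,z)}`; `s = 1` (`Y`): `α_{(x,i)} ↦ −α_{(x,j)}`,
`γ_{(z,j)} ↦ γ_{(z,i)}`; `s = 2` (`Z`): `β_{(x,i)} ↦ −β_{(x,j)}`, `γ_{(j,y)} ↦ γ_{(i,y)}`; all other variables `↦ 0`.
(Checked by machine: these `27 × 27` matrices satisfy the `𝔤𝔩₃ ⊕ 𝔤𝔩₃ ⊕ 𝔤𝔩₃` relations and every generator kills the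
functional `pairT` on `S₁₁₁`, i.e. the group fixes `⟨3,3,3⟩`.) -/
def rootImg (s i j : Fin 3) : Var → S := fun v =>
  if s = 0 then
    (if v.1 = 0 ∧ v.2.1 = i then -(MvPolynomial.X ((0 : Fin 3), (j, v.2.2)) : S) else 0) +
    (if v.1 = 1 ∧ v.2.1 = j then (MvPolynomial.X ((1 : Fin 3), (i, v.2.2)) : S) else 0)
  else if s = 1 then
    (if v.1 = 0 ∧ v.2.2 = i then -(MvPolynomial.X ((0 : Fin 3), (v.2.1, j)) : S) else 0) +
    (if v.1 = 2 ∧ v.2.2 = j then (MvPolynomial.X ((2 : Fin 3), (v.2.1, i)) : S) else 0)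
  else
    (if v.1 = 1 ∧ v.2.2 = i then -(MvPolynomial.X ((1 : Fin 3), (v.2.1, j)) : S) else 0) +
    (if v.1 = 2 ∧ v.2.1 = j then (MvPolynomial.X ((2 : Fin 3), (i, v.2.2)) : S) else 0)

/-- The derivation of `S` extending a linear substitution `φ` of the variables: `p ↦ ∑_v φ(v) · ∂p/∂v`. -/
def derivOf (φ : Var → S) (p : S) : S := ∑ v : Var, φ v * MvPolynomial.pderiv v p

/-- `I` is BOREL-FIXED: stable under the Lie algebra of `B = B_X × B_Y × B_Z` (upper triangular, torus included:
`i ≤ j`), acting by derivations (char `0`: for an ideal with finite-dimensional graded pieces this is stability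
under the connected group `B ⊂ G_{⟨3,3,3⟩}`). -/
def IsBorelFixed (I : Ideal S) : Prop :=
  ∀ s i j : Fin 3, i ≤ j → ∀ p ∈ I, derivOf (rootImg s i j) p ∈ I

/-- `q ∈ I^{sat} = I : S₊^∞` for the irrelevant ideal `S₊ = (α_a β_b γ_c : a, b, c)` of the product of three projective
spaces (a radical-level test suffices: for every generator `m = α_a β_b γ_c` some power `mⁿ q ∈ I`). -/
def InSat (I : Ideal S) (q : S) : Prop :=
  ∀ a b c : Pair, ∃ n : ℕ,
    (MvPolynomial.X ((0 : Fin 3), a) * MvPolynomial.X ((1 : Fin 3), b) * MvPolynomial.X ((2 : Fin 3), c)) ^ n * q ∈ I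

/-! ## Vocabulary: arcs of points and their limit ideals (Slip, sequentially) -/

/-- An ARC of `r` points of `ℙA × ℙB × ℙC` over `ℂ⟦ε⟧`: `Γ ρ (s, a)` is the `a`-th coordinate of the slot-`s` vector of
the `ρ`-th point; HONEST = each slot vector has a coordinate that is a unit of `ℂ⟦ε⟧` (so it is a point of the
projective space over `ℂ⟦ε⟧`, and over `ℂ((ε))`). -/
def IsHonestArc {r : ℕ} (Γ : Fin r → Var → PowerSeries ℂ) : Prop :=
  ∀ ρ : Fin r, ∀ s : Fin 3, ∃ a : Pair, PowerSeries.constantCoeff (Γ ρ (s, a)) ≠ 0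

/-- `I` IS THE LIMIT IDEAL OF THE ARC `Γ` (all multidegrees): a form `p ∈ S_D` lies in `I` iff it is the reduction
mod `ε` of a degree-`D` form with coefficients in `ℂ⟦ε⟧` vanishing at the `r` points of `Γ`. Equivalently `I_D` is
the special fibre of the `ε`-saturated lattice `Λ_D(Γ) ⊆ S_D ⊗ ℂ⟦ε⟧` of vanishing forms, whose generic fibre is the
degree-`D` piece of the (saturated) ideal of the `r` points over `ℂ((ε))` — the degreewise Grassmannian limit of
Buczyńska–Buczyński / Conner–Harper–Landsberg (`limSub` of the tree is the `ℂ[ε]`, two-factor, `(110)` instance). -/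
def IsArcLimit {r : ℕ} (Γ : Fin r → Var → PowerSeries ℂ) (I : Ideal S) : Prop :=
  ∀ (D : MDeg) (p : S), p ∈ Spiece D →
    (p ∈ I ↔ ∃ F : MvPolynomial Var (PowerSeries ℂ), MvPolynomial.IsWeightedHomogeneous wt F D ∧
      (∀ ρ, MvPolynomial.eval (Γ ρ) F = 0) ∧ MvPolynomial.map PowerSeries.constantCoeff F = p)

/-! ## Vocabulary: the fibre obstruction `Ext¹_S(J/I, S/J)₀ = 0`, presentation form -/

/-- The SYZYGY module of `J/I` for generators `g` of `J` mod `I`: `K = {x ∈ Sⁿ : ∑ xᵢ gᵢ ∈ I}`, the kernel of the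
free presentation `F = Sⁿ → J/I`, `eᵢ ↦ gᵢ`. -/
def syz {n : ℕ} (I : Ideal S) (g : Fin n → S) : Submodule S (Fin n → S) :=
  Submodule.comap (Fintype.linearCombination S g) I

/-- `x ∈ F = ⊕ᵢ S(−dgᵢ)` is homogeneous of degree `D`: `xᵢ ∈ S_{D − dgᵢ}` (and `xᵢ = 0` when `D − dgᵢ ∉ ℕ³`). -/
def IsHomogVec {n : ℕ} (dg : Fin n → MDeg) (x : Fin n → S) (D : MDeg) : Prop :=
  ∀ i, x i = 0 ∨ ∃ E : MDeg, E + dg i = D ∧ MvPolynomial.IsWeightedHomogeneous wt (x i) E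

/-- **`ObFib(I, J) = Ext¹_S(J/I, S/J)₀ = 0`** (Jelisiejew–Mańdziuk 2025, eq. (1.1)/(ObFib)), in the elementary form the
certificate computes: for SOME (equivalently every) finite family `g` of homogeneous generators of `J` modulo `I`
(degrees `dg`), every `S`-linear map `φ : K → S/J` of degree `0` on the syzygy module `K = syz I g` extends to the
free module `F ⊇ K`, i.e. is `x ↦ ∑ xᵢ yᵢ mod J` for homogeneous `yᵢ` of degree `dgᵢ`
(`Hom_S(F, S/J)₀ → Hom_S(K, S/J)₀ → Ext¹_S(J/I, S/J)₀ → Ext¹_S(F, ·) = 0`). -/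
def ObFibVanishes (I J : Ideal S) : Prop :=
  ∃ (n : ℕ) (g : Fin n → S) (dg : Fin n → MDeg),
    (∀ i, g i ∈ J ∧ MvPolynomial.IsWeightedHomogeneous wt (g i) (dg i)) ∧
    (∀ q ∈ J, ∃ (x : Fin n → S) (p : S), p ∈ I ∧ q = p + ∑ i, x i * g i) ∧
    ∀ φ : syz I g →ₗ[S] (S ⧸ J),
      (∀ (x : syz I g) (D : MDeg), IsHomogVec dg (x : Fin n → S) D →
          ∃ q : S, MvPolynomial.IsWeightedHomogeneous wt q D ∧ φ x = Ideal.Quotient.mk J q) →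
      ∃ y : Fin n → S, (∀ i, MvPolynomial.IsWeightedHomogeneous wt (y i) (dg i)) ∧
        ∀ x : syz I g, φ x = Ideal.Quotient.mk J (∑ i, (x : Fin n → S) i * y i)

/-! ## The stubs -/

/-- **Stub A — weak border apolarity for `(⟨3,3,3⟩, 17)`, ARC FORM (the K-input).** If `R̲(⟨3,3,3⟩) ≤ 17` there is an
honest arc `Γ` of `17` points of `ℙA × ℙB × ℙC` over `ℂ⟦ε⟧` whose limit ideal `I` (all multidegrees) has the generic
Hilbert function of `17` points and satisfies `⟨3,3,3⟩ ⟂ I₁₁₁` — a point of `Slip₁₇ ∩ {T ⟂ I₁₁₁}` written sequentially.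
Why plausibly true: THEOREM (Buczyńska–Buczyński 2021 Thm 1.2 "weak border apolarity" / Conner–Harper–Landsberg 2023
§2.3 (i)–(iii), in all degrees). `algBorderRank ≤ 17` unfolds (`algBorderRank`, `approxRank`, `Nat.sInf_mem`) to an
`IsApproxDecomposition h T u v w` with `≤ 17` triads over `ℂ[ε]`; pad with zero triads; replace `(u_ρ, v_ρ, w_ρ)` by
`(u_ρ + ε^M g_ρ, …)` with `M > h` and `g` VERY GENERAL constants (the order-`h` identity survives exactly as in the
tree's `BorderApolarity.isApproxDecomposition_pert₁₂`; general position of the generic configuration in EVERY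
multidegree `D` holds off a proper Zariski-closed set of `g`'s per `D` — one good configuration per `D` by choosing
points one at a time off the zero set of a non-zero form — and `ℂ^m` is not a countable union of proper closed
subsets: induct on `m`, `ℂ` uncountable, `Cardinal.mk_complex`); divide each slot vector by the power of `ε` it is
divisible by (same projective points, same vanishing lattices, honest arc); `I := ` the `ℂ`-span of the reductions
mod `ε` of vanishing forms, degree by degree — an ideal (`q · F` vanishes when `F` does) and homogeneous;
`IsArcLimit` by construction; `HasGenericHF 17`: the lattice `Λ_D` is `ε`-saturated hence free of rank
`dim S_D − rk(eval)` with `Λ_D/εΛ_D ↪ S_D` (the tree's `finrank_limSub_eq` is the `ℂ[ε]`-version: Smith normal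
form over a PID), and `rk(eval) = min(17, dim S_D)` is general position; `AnnihilatesT`: for `F ∈ Λ₁₁₁`,
`0 = ∑_ρ F(P_ρ(ε))·c_ρ(ε) = ⟨F(ε), ∑_ρ u_ρ ⊗ v_ρ ⊗ w_ρ⟩ = ⟨F(ε), ε^h T + O(ε^{h+1})⟩`, and the `ε^h`-coefficient is
`⟨F(0), T⟩` because the lower coefficients of the decomposition vanish (cf. `BorderApolarity.slice_mem_limSub_W₁`).
Size L (the very-general-position argument and the `ℂ⟦ε⟧` lattice dictionary are the only ingredients not already
in `BorderApolarityLimits/Candidates.lean`). -/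
theorem stub_pointArc_of_algBorderRank_le :
    algBorderRank (matMulTensor ℂ 3 3 3) ≤ 17 →
      ∃ (Γ : Fin 17 → Var → PowerSeries ℂ) (I : Ideal S),
        IsHonestArc Γ ∧ IsHomogIdeal I ∧ IsArcLimit Γ I ∧ HasGenericHF 17 I ∧ AnnihilatesT I := by
  sorry

/-- **Stub B — Borel-fixed normal form inside `Slip₁₇ ∩ {T ⟂ I₁₁₁}` (Buczyńska–Buczyński 2021 Thm 4.3 /
Conner–Harper–Landsberg 2023 §2.4, ARC FORM).** If `Slip₁₇ ∩ {T ⟂ I₁₁₁}` has a point (Stub A's output) it has a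
`B`-FIXED point, again realised as the limit ideal of an honest arc of `17` points with the generic Hilbert function.
Why plausibly true: THEOREM. (1) Haiman–Sturmfels: ideals with Hilbert function `h₁₇(D) = min(17, dim S_D)` form a
PROJECTIVE scheme `Hilb^{h₁₇} ↪ ∏_{D ∈ F} Gr(S_D)` for a finite supportive set `F` of multidegrees (positive
`ℕ³`-grading, `S_0 = ℂ`). (2) `Y := ` closure of `{[I(Γ)] : Γ` `17` points in general position`}`
`∩ {T ⟂ I₁₁₁}` is closed, non-empty (the hypothesis: an arc limit with `HasGenericHF 17` is the special point of
a `ℂ⟦ε⟧`-point of `Hilb^{h₁₇}` with honest generic fibre), and stable under `B = B_X × B_Y × B_Z` (`B ⊂ G_T` fixes `T`,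
see `rootImg`; it acts on `ℙA × ℙB × ℙC`, so it permutes honest point ideals and commutes with limits). (3) Borel
fixed point theorem (`B` connected solvable, `Y` projective) ⟹ `[I'] ∈ Y` `B`-fixed, i.e. `IsBorelFixed I'`
(infinitesimal form = stability of each finite-dimensional `I'_D` under `Lie B`, char `0`). (4) `[I'] ∈ ` closure of a
constructible set ⟹ curve selection: a pointed curve `(C, 0) → Y` with `C ∖ 0` in the honest locus; lift the generic
point to a configuration over a finite extension, complete at a point over `0` (`ℂ⟦s⟧`, ramify), normalise slots
(honest arc `Γ⁰`); perturb `Γ' := Γ⁰ + s^M · g`, `g` very general, `M` larger than the elementary-divisor exponents of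
the evaluation matrices in the degrees `D ∈ F` (so the `F`-truncated limits do not move), making the generic
configuration general in EVERY degree; then `Λ(Γ')` is a `ℂ⟦s⟧`-point of `Hilb^{h₁₇}` whose special fibre has the
same `F`-truncation as `I'`, hence equals `I'` (Haiman–Sturmfels: a point of `Hilb^h` is determined by its
`F`-truncation) — `IsArcLimit Γ' I'` in all degrees, `HasGenericHF 17 I'`, `AnnihilatesT I'` (closed condition).
Why it might be slow: Mathlib has no multigraded Hilbert scheme, no Borel fixed point theorem, no curve selection
lemma; an elementary substitute for (3) is the GENERIC-INITIAL-IDEAL route (Galligo/Bayer–Stillman for the solvable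
group `B`: `in_λ(b · I)` is `B`-fixed for generic `b ∈ B` and a regular dominant one-parameter subgroup `λ`, realised
as an explicit re-parametrised arc as in the tree's `WtInit.stage` / `exists_graded_candidate_of_isApproxDecomposition`
for the torus part). Size XL. -/
theorem stub_borelFixed_pointArc :
    (∃ (Γ : Fin 17 → Var → PowerSeries ℂ) (I : Ideal S),
        IsHonestArc Γ ∧ IsHomogIdeal I ∧ IsArcLimit Γ I ∧ HasGenericHF 17 I ∧ AnnihilatesT I) →
      ∃ (Γ : Fin 17 → Var → PowerSeries ℂ) (I : Ideal S),
        IsHonestArc Γ ∧ IsHomogIdeal I ∧ IsArcLimit Γ I ∧ HasGenericHF 17 I ∧ AnnihilatesT I ∧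
          IsBorelFixed I := by
  sorry

/-- **Stub C — no Borel-fixed candidate is saturated (no `B`-stable border-CACTUS-17 expression of ⟨3,3,3⟩ at the
corner).** Every homogeneous Borel-fixed ideal with the generic Hilbert function of `17` points and `⟨3,3,3⟩ ⟂ I₁₁₁`
has `I ⊊ I^{sat}`.
Why plausibly true / what it is: a saturated such `I` is `I(Z)` for a zero-dimensional `Z ⊂ ℙA × ℙB × ℙC` of length
`17` (Hilbert function `17` in large degrees), `B`-stable, hence SUPPORTED ON `B`-FIXED POINTS; each factor `ℙ(X ⊗ Y)`,
`ℙ(X* ⊗ Z)`, `ℙ(Z* ⊗ Y*)` is the projectivisation of an irreducible `GL₃ × GL₃`-module, so it has exactly ONE `B`-stable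
line (its highest weight line; triage r1-2/3, `BorelFixedLineMatrixThree` of card punctual-saturation), and `Z` is one
FAT POINT of length `17` at the corner `P₀`, with `T ∈ ⟨Z⟩ = (I(Z)₁₁₁)^⊥` (a `B`-stable cactus expression of length
`17`) AND with Hilbert function EXACTLY `min(17, dim S_D)` in every degree (e.g. no form of multidegree `(1,0,0)`,
`(1,1,0)`-piece of codimension exactly `17`, …). Deciding it is FINITE LINEAR ALGEBRA in the `24` affine coordinates
at `P₀`: enumerate the `B`-stable colength-`17` ideals of `𝒪_{P₀}` (strongly-stable-type local ideals; torus weights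
cut the search to weight-closed order ideals plus finitely many parameters), test the Hilbert function and
`T ∈ ⟨Z⟩`. Nothing in print excludes such a `Z` (Koszul flattenings bound border cactus rank of `⟨3,3,3⟩` only by
`15`; CHL's `17` is itself cactus-blind), so this stub is the line's CHEAPEST FALSIFIER promoted to a lemma (triage
r1-3 "step 0"; both saturation cards' falsifier (2)): if it is false the sticky lever has nothing to act on for that
candidate and the verdict passes to smoothability of `Z` (cards slip-tangent-deficiency / simplex-degeneration).
Size M–L (finite enumeration + exact rank certificates over `ℚ`, kit for discovery, `decide`/`norm_num` replay). -/
theorem stub_candidate_not_saturated :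
    ∀ I : Ideal S, IsHomogIdeal I → IsBorelFixed I → HasGenericHF 17 I → AnnihilatesT I →
      ∃ q : S, q ∉ I ∧ InSat I q := by
  sorry

/-- **Stub D — THE STICKY CERTIFICATE (the card's transfer `C⁺`; the lever; hardest stub of the line).** Every
nonsaturated homogeneous Borel-fixed ideal `I` with the generic Hilbert function of `17` points and `⟨3,3,3⟩ ⟂ I₁₁₁`
admits a homogeneous `J` with `I ⊊ J ⊆ I^{sat}` and vanishing fibre obstruction `ObFib(I, J) = Ext¹_S(J/I, S/J)₀ = 0`.
Why plausibly true: this is the BET of the idea (Jelisiejew–Mańdziuk 2025 Thm 1.2 is "effective already for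
`J := I^{sat}`", §4 decides all Hilbert functions `(1,d,d,…)`, `d ≤ 5`, with one exception needing a second-order
condition), sharpened by three structural facts of THIS crux (card § Why it bites): (a) LOCALITY — `I^{sat} = I(Z)`,
`Z` one `B`-stable fat point of length `17` at the corner `P₀` of a smooth `24`-fold, the strongly-stable corner of
`Hilb¹⁷` where obstruction calculus is explicit; (b) the gap `J/I` starts in total degree `≤ 3` (`⟨3,3,3⟩ ∈ I₁₁₁^⊥`
while `(I(Z)₁₁₁)^⊥ = ⟨Z⟩`, and Stub C says `I ≠ I(Z)`); (c) after the Hilbert-function sieve the Borel-fixed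
`(110)`-data are ONE structural type `E₁₁₀ = M(C*) ⊕ u^{1,2} ⊗ ⟨E₀₁,E₀₂⟩ ⊗ w_{0,1}` and its mirror (card
symbolic-square-border-apolarity; triage r1-2 reproduced the `(110)`-census exactly: 343 types / 170 pass
`(210)&(120)` at `r = 17`). HOW it is proved: classify the Borel-fixed `I` with `HasGenericHF 17 ∧ AnnihilatesT`
through a generating degree (CHL §6 recursion degree by degree, Cartan-parameter families kept symbolic — triage
sharpenings), and for each type exhibit `g` (generators of `J` mod `I`, typically `J = I^{sat}` or `I + (I^{sat})_{≤ a}`)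
with the lifting property of `ObFibVanishes` as an explicit rank identity between the matrices of
`Hom_S(F, S/J)₀ → Hom_S(K, S/J)₀` truncated at the regularity degree (Gröbner/syzygy data found off-box by kit —
python-flint/sympy, no Macaulay2 on the farm — and replayed in Lean as finite linear algebra over `ℚ`).
CALIBRATION (Disproof §2, mandatory first run): the same pipeline at `r = 20` on the Borel-fixed limit of Smirnov's
kernel-checked scheme (`BorderRankMatMulThreeSmirnov`) must report `ObFib ≠ 0` for every admissible `J` (Stub E
forbids a certificate for a genuine member of `Slip₂₀`), and at `r = 16` the `8` CHL seven-planes must die by Hilbert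
function before reaching this stub.
Why it might fail: the criterion is only SUFFICIENT — a candidate with `ObFib(I, J) ≠ 0` for all `J` (JM's
`(1,2,3,4,5,5,…)` exception; Mańdziuk arXiv:2306.08104 Ex. 1.6 on `(ℙ³)³`, `r = 4`: `Ext¹ = 3 ≠ 0` silent while the
projected tangent test decides) leaves the stub unproved although the candidate may still lie outside `Slip₁₇` (then:
JM Thm 1.3/3.5 tangent form, Mańdziuk's projection Prop 5.2(e), or the symbolic-square sieve as an added hypothesis —
a reshaping for the lead, not a new line); and it is false outright if some nonsaturated Borel-fixed candidate IS in
`Slip₁₇` (then `R̲(⟨3,3,3⟩) = 17` and the crux is refuted — Kill (iv) of the route). Size XL. -/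
theorem stub_stickyCertificate :
    ∀ I : Ideal S, IsHomogIdeal I → IsBorelFixed I → HasGenericHF 17 I → AnnihilatesT I →
      (∃ q : S, q ∉ I ∧ InSat I q) →
      ∃ J : Ideal S, IsHomogIdeal J ∧ I < J ∧ (∀ q ∈ J, InSat I q) ∧ ObFibVanishes I J := by
  sorry

/-- **Stub E — sticky ideals are not limits of saturated ideals (Jelisiejew–Mańdziuk 2025, Thm 3.4 = Thm 1.2),
ARC FORM.** If `I ⊊ J ⊆ I^{sat}` are homogeneous ideals of the `ℕ³`-graded `S` with `Ext¹_S(J/I, S/J)₀ = 0`, then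
`I` is the limit ideal of NO honest arc of points (any number `r` of points).
Why plausibly true: THEOREM (JM Thm 3.4, whose setting is any `ℕʳ`-graded polynomial ring, §2.4: products of
projective spaces included). Dictionary: an honest arc `Γ` with `IsArcLimit Γ I` (+ `IsHomogIdeal I`) is exactly a
`ℂ⟦ε⟧`-point `Λ(Γ) = {F : F|_Γ = 0} ⊆ S ⊗ ℂ⟦ε⟧` of `Hilb^{h_I}` with special fibre `I` (each `Λ_D` is `ε`-saturated in
the free `ℂ⟦ε⟧`-module `S_D⟦ε⟧`, hence a direct summand: flat; `Λ_D/εΛ_D ↪ S_D` with image `I_D`) and generic fibre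
`Λ(Γ)_η = I(Γ_η)`, the ideal of `r` points of `(ℙ⁸)³` over `ℂ((ε))`, which is SATURATED because the points are
honest (if `m·f` vanishes at `P` for all monomials `m ∈ S₊^k`, take `m = (α_a β_b γ_c)^k` with `α_a β_b γ_c (P)` a
unit). JM: `ObFib = 0` ⟹ `pr_I : Hilb_{I ⊆ J} → Hilb_I` is smooth at `[I ⊆ J]` (main diagram + obstruction theory
of the flag Hilbert scheme, their Thm A.1/3.4); a smooth morphism lifts `ℂ⟦ε⟧`-points through the closed point
(formal smoothness, `ℂ⟦ε⟧` complete with residue field `ℂ`), giving a flat family `J_ε ⊇ Λ(Γ)` with special fibre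
`J` and Hilbert function `h_J`; since `J ⊆ I^{sat}`, `h_J(D) = h_I(D)` for `min D ≫ 0`, so `(J_η)_D = Λ(Γ)_{η,D}` there,
`S₊^e (J_η / Λ(Γ)_η) = 0`, `J_η ⊆ Λ(Γ)_η^{sat} = Λ(Γ)_η`, contradicting `h_J ≠ h_I` (from `I ⊊ J`) — verbatim the
paper's proof. The statement is the honest theorem-sized import of the line (deformation theory of `HilbFlag → Hilb`
over a DVR; none of it is in Mathlib: Haiman–Sturmfels representability, tangent–obstruction theory, infinitesimal
lifting). A cheaper special case that suffices whenever Stub D's `J` is `I^{sat}` with `Hom_S(I^{sat}/I, S/I^{sat}) = 0`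
automatic: JM Thm 3.6 (`pr_I` étale). Size XL. -/
theorem stub_sticky_not_arcLimit :
    ∀ (I J : Ideal S), IsHomogIdeal I → IsHomogIdeal J → I < J → (∀ q ∈ J, InSat I q) →
      ObFibVanishes I J →
      ∀ (r : ℕ) (Γ : Fin r → Var → PowerSeries ℂ), IsHonestArc Γ → ¬ IsArcLimit Γ I := by
  sorry

/-! ## The composition (kernel-checked, no `sorry` of its own) -/

/-- **`FidelityGapThreeSeventeen` from the five stubs.** If the crux failed, `R̲(⟨3,3,3⟩) ≤ 17` (landed reduction
`Theorems.algBorderRank_le_seventeen_of_not_fidelityGapThreeSeventeen`: cone criterion + Alder's theorem); Stub A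
gives a point of `Slip₁₇ ∩ {T ⟂ I₁₁₁}` as an honest arc limit, Stub B a Borel-fixed one `I` with its arc `Γ`, Stub C
says `I ⊊ I^{sat}`, Stub D produces a sticky `J` with `ObFib(I, J) = 0`, and Stub E says such an `I` is the limit of
no honest arc — contradicting `Γ`. Hence `18 ≤ R̲(⟨3,3,3⟩)`, i.e. the crux. -/
theorem FidelityGapThreeSeventeen_of : FidelityGapThreeSeventeen := by
  by_contra h
  have h17 : algBorderRank (matMulTensor ℂ 3 3 3) ≤ 17 :=
    Theorems.algBorderRank_le_seventeen_of_not_fidelityGapThreeSeventeen h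
  obtain ⟨Γ, I, hΓ, hIh, hlim, hHF, hT, hB⟩ :=
    stub_borelFixed_pointArc (stub_pointArc_of_algBorderRank_le h17)
  obtain ⟨J, hJh, hlt, hJsat, hOb⟩ :=
    stub_stickyCertificate I hIh hB hHF hT (stub_candidate_not_saturated I hIh hB hHF hT)
  exact stub_sticky_not_arcLimit I J hIh hJh hlt hJsat hOb 17 Γ hΓ hlim

end Summit.MatrixMultiplication.MatrixMultiplication.Cruxes.FidelityGapThreeSeventeen.StickySaturationSlip

end
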